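import Mathlib
import Summits.MatrixMultiplication.MatrixMultiplication.Theorems.SnSubsetDichotomyPolynomialSlackBalancedThreeQuarters

/-!
# Beating the `√n` wall forces a dense quotient set (unconditional)

Crux `Summit.MatrixMultiplication.MatrixMultiplication.Theses.SnSubsetDichotomy.PolynomialSlack`
(item `stmt-MatrixMultiplication-8306`), level-one programme: the STRUCTURE half of the level-one dichotomy.
`dense_pair_of_beating_wall`: for `n ≥ 4096`, if a TPP triple `S, T, U ⊆ S_n` has volume
`|S||T||U| ≥ λ·n!·√(n!)/√n` with `λ ≥ 64/√n` (`λ` measures the volume against the quasirandom wall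
`(n!)^{3/2}/√n`; the hypothesis is `|S||T||U| ≥ 64·(n!)^{3/2}/n`), then one of the three pair products
`|S||T|, |T||U|, |U||S|` is at least `λ²·n!/(1.5·10⁶·log² n)` — i.e. one of the (injectively parametrised)
quotient sets `S⁻¹T, T⁻¹U, U⁻¹S` fills a fraction `≥ λ²/(1.5·10⁶ log² n)` of `S_n`. In particular a
counterexample to the crux at exponent `C ∈ (1/2, 1)` (`λ = n^{1/2-C}`) has a quotient set of density
`≥ n^{1-2C}/(1.5·10⁶ log² n)`: the residual ("lopsided") regime left open by level one is a problem about TPP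
triples two of whose members nearly factorise `S_n`.
-/

namespace Summit.MatrixMultiplication.MatrixMultiplication.Theorems.PolynomialSlack

open scoped BigOperators
open Literature.Combinatorics.Additive (TripleProductProperty)

-- `Summit.<Summit>.<Problem>` is the tree's mandated summit-side namespace (CONVENTIONS §2); for
-- this single-conjunct summit the two coincide, so each declaration silences `dupNamespace`.
set_option linter.dupNamespace false

/-- **Large volume forces a dense quotient set** (unconditional; `n ≥ 4096`): if `S, T, U ⊆ S_n` have
the triple product property and `|S||T||U| ≥ λ·n!√(n!)/√n` with `λ ≥ 64/√n`, then
`λ²·n! ≤ 1.5·10⁶·log² n · max(|S||T|, |T||U|, |U||S|)` (stated as a disjunction). Proof: all pair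
products are `≥ λ²·n!/n`, so the logarithms in `nearWall` are `≤ 3 log n`; if all three pair products were
below `q = λ² n!/(1.5·10⁶ log² n)` then `nearWall` would give `|S||T||U| ≤ 1200·n!·log n·√q/√n`, whose
square is `< λ²(n!)³/n ≤ |S||T||U|²`. [folklore] -/
theorem dense_pair_of_beating_wall {n : ℕ} (hn : 4096 ≤ n) (S T U : Finset (Equiv.Perm (Fin n)))
    (hTPP : TripleProductProperty S T U) (lam : ℝ) (hlam : 64 / Real.sqrt n ≤ lam)
    (hbig : lam * ((n.factorial : ℝ) * Real.sqrt (n.factorial : ℝ) / Real.sqrt n) ≤ (S.card * T.card * U.card : ℕ)) :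
    lam ^ 2 * n.factorial ≤ 1500000 * Real.log n ^ 2 * (S.card * T.card : ℕ) ∨
      lam ^ 2 * n.factorial ≤ 1500000 * Real.log n ^ 2 * (T.card * U.card : ℕ) ∨
      lam ^ 2 * n.factorial ≤ 1500000 * Real.log n ^ 2 * (U.card * S.card : ℕ) := by
  have hn40 : 40 ≤ n := by omega
  have h40 : (40 : ℝ) ≤ n := by exact_mod_cast hn40
  have h4096 : (4096 : ℝ) ≤ n := by exact_mod_cast hn
  have hn0 : (0 : ℝ) < n := by linarith only [h40]
  have hF0 : (0 : ℝ) < n.factorial := by exact_mod_cast n.factorial_pos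
  -- the players
  obtain ⟨f, hf⟩ : ∃ f : ℝ, f = Real.sqrt (n.factorial : ℝ) := ⟨_, rfl⟩
  obtain ⟨s, hs⟩ : ∃ s : ℝ, s = Real.sqrt (n : ℝ) := ⟨_, rfl⟩
  obtain ⟨ℓ, hℓ⟩ : ∃ ℓ : ℝ, ℓ = Real.sqrt (Real.log n) := ⟨_, rfl⟩
  obtain ⟨a, ha⟩ : ∃ a : ℝ, a = (S.card : ℝ) := ⟨_, rfl⟩
  obtain ⟨b, hb⟩ : ∃ b : ℝ, b = (T.card : ℝ) := ⟨_, rfl⟩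
  obtain ⟨c, hc⟩ : ∃ c : ℝ, c = (U.card : ℝ) := ⟨_, rfl⟩
  have hf0 : 0 < f := by rw [hf]; exact Real.sqrt_pos.mpr hF0
  have hs0 : 0 < s := by rw [hs]; exact Real.sqrt_pos.mpr hn0
  have hlog1 : 1 ≤ Real.log n := by
    rw [← Real.log_exp 1]
    exact Real.log_le_log (Real.exp_pos 1) (le_trans (le_of_lt (lt_trans Real.exp_one_lt_d9 (by norm_num))) h40)
  have hℓpos : 0 < ℓ := by rw [hℓ]; exact Real.sqrt_pos.mpr (by linarith)
  have hFf : (n.factorial : ℝ) = f ^ 2 := by rw [hf, Real.sq_sqrt hF0.le]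
  have hns : (n : ℝ) = s ^ 2 := by rw [hs, Real.sq_sqrt hn0.le]
  have hlog : Real.log n = ℓ ^ 2 := by rw [hℓ, Real.sq_sqrt (by linarith)]
  -- `λ > 0`, `λ s ≥ 64`, `f ≥ s²/4`
  rw [← hs] at hlam
  have hlam0 : 0 < lam := lt_of_lt_of_le (by positivity) hlam
  have hls : 64 ≤ lam * s := by rwa [div_le_iff₀ hs0] at hlam
  have hfn : s ^ 2 / 4 ≤ f := by
    have h1 : ((n * (n - 1) : ℕ) : ℝ) ≤ n.factorial := by
      have : n * (n - 1) ≤ n.factorial := by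
        rw [← Nat.mul_factorial_pred (show n ≠ 0 by omega)]
        exact Nat.mul_le_mul_left n (Nat.self_le_factorial _)
      exact_mod_cast this
    have h2 : ((n * (n - 1) : ℕ) : ℝ) = (n : ℝ) * ((n : ℝ) - 1) := by
      push_cast [Nat.cast_sub (show 1 ≤ n by omega)]; ring
    have h3 : (s ^ 2 / 4) ^ 2 ≤ n.factorial := by rw [← hns]; nlinarith only [h1, h2, h40]
    have := Real.abs_le_sqrt h3
    rwa [abs_of_nonneg (by positivity), ← hf] at this
  -- casts
  have hN : ((S.card * T.card * U.card : ℕ) : ℝ) = a * b * c := by rw [ha, hb, hc]; push_cast; ring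
  have hAB : ((S.card * T.card : ℕ) : ℝ) = a * b := by rw [ha, hb]; push_cast; ring
  have hBC : ((T.card * U.card : ℕ) : ℝ) = b * c := by rw [hb, hc]; push_cast; ring
  have hCA : ((U.card * S.card : ℕ) : ℝ) = c * a := by rw [hc, ha]; push_cast; ring
  have hW := nearWall hn40 S T U hTPP
  rw [hN, hAB, hBC, hCA, ← hs] at hW
  rw [hN, ← hf, ← hs] at hbig
  rw [hAB, hBC, hCA, hlog, hFf]
  -- the volume is large: `abc ≥ λ f³/s ≥ 64 f³/s² > 0`
  rw [hFf] at hbig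
  have hV64 : 64 * (f ^ 2 * f) / s ^ 2 ≤ a * b * c := by
    calc 64 * (f ^ 2 * f) / s ^ 2 = 64 / s * (f ^ 2 * f / s) := by field_simp
      _ ≤ lam * (f ^ 2 * f / s) := mul_le_mul_of_nonneg_right hlam (by positivity)
      _ ≤ a * b * c := hbig
  have hV0 : 0 < a * b * c := lt_of_lt_of_le (by positivity) hV64
  have ha0' : 0 ≤ a := by rw [ha]; exact Nat.cast_nonneg _
  have hb0' : 0 ≤ b := by rw [hb]; exact Nat.cast_nonneg _
  have hc0' : 0 ≤ c := by rw [hc]; exact Nat.cast_nonneg _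
  have ha0 : 0 < a := by
    by_contra h
    have e : a = 0 := le_antisymm (not_lt.mp h) ha0'
    rw [e, zero_mul, zero_mul] at hV0; exact lt_irrefl _ hV0
  have hb0 : 0 < b := by
    by_contra h
    have e : b = 0 := le_antisymm (not_lt.mp h) hb0'
    rw [e, mul_zero, zero_mul] at hV0; exact lt_irrefl _ hV0
  have hc0 : 0 < c := by
    by_contra h
    have e : c = 0 := le_antisymm (not_lt.mp h) hc0'
    rw [e, mul_zero] at hV0; exact lt_irrefl _ hV0
  have hSne : S.Nonempty := Finset.card_pos.mp (Nat.cast_pos.mp (by rw [← ha]; exact ha0))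
  have hTne : T.Nonempty := Finset.card_pos.mp (Nat.cast_pos.mp (by rw [← hb]; exact hb0))
  have hUne : U.Nonempty := Finset.card_pos.mp (Nat.cast_pos.mp (by rw [← hc]; exact hc0))
  -- pair products are at most `f²` …
  have hab : a * b ≤ f ^ 2 := by
    have := card_mul_card_le_factorial_of_injOn (injOn_quot_first hTPP hUne)
    rw [ha, hb, ← hFf]; exact_mod_cast this
  have hbc : b * c ≤ f ^ 2 := by
    have := card_mul_card_le_factorial_of_injOn (injOn_quot_second hTPP hSne)
    rw [hb, hc, ← hFf]; exact_mod_cast this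
  have hca : c * a ≤ f ^ 2 := by
    have := card_mul_card_le_factorial_of_injOn (injOn_quot_first hTPP.rotate.rotate hTne)
    rw [hc, ha, ← hFf]; exact_mod_cast this
  -- … and at least `λ² f²/n`
  have hsq : (lam * (f ^ 2 * f / s)) ^ 2 ≤ (a * b * c) ^ 2 := pow_le_pow_left₀ (by positivity) hbig 2
  have hsq' : (lam * (f ^ 2 * f / s)) ^ 2 = f ^ 2 * f ^ 2 * (lam ^ 2 * f ^ 2 / s ^ 2) := by field_simp
  have hlow : ∀ {x y z w v u : ℝ}, x * y * (z * w) * (v * u) = (a * b * c) ^ 2 → 0 ≤ x * y → z * w ≤ f ^ 2 → v * u ≤ f ^ 2 →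
      0 ≤ z * w → lam ^ 2 * f ^ 2 / s ^ 2 ≤ x * y := by
    intro x y z w v u hprod hxy hzw hvu hzw0
    by_contra h
    rw [not_le] at h
    have h1 : x * y * (z * w) * (v * u) ≤ x * y * f ^ 2 * f ^ 2 := by
      calc x * y * (z * w) * (v * u) ≤ x * y * (z * w) * f ^ 2 :=
            mul_le_mul_of_nonneg_left hvu (mul_nonneg hxy hzw0)
        _ ≤ x * y * f ^ 2 * f ^ 2 := by
            rw [mul_assoc (x * y), mul_assoc (x * y)]
            exact mul_le_mul_of_nonneg_left (mul_le_mul_of_nonneg_right hzw (by positivity)) hxy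
    have h2 : x * y * f ^ 2 * f ^ 2 < lam ^ 2 * f ^ 2 / s ^ 2 * f ^ 2 * f ^ 2 := by
      have : 0 < f ^ 2 * f ^ 2 := by positivity
      nlinarith only [h, this]
    rw [hprod] at h1
    nlinarith only [hsq, hsq', h1, h2]
  have hlab : lam ^ 2 * f ^ 2 / s ^ 2 ≤ a * b := hlow (by ring) (by positivity) hbc hca (by positivity)
  have hlbc : lam ^ 2 * f ^ 2 / s ^ 2 ≤ b * c := hlow (by ring) (by positivity) hca hab (by positivity)
  have hlca : lam ^ 2 * f ^ 2 / s ^ 2 ≤ c * a := hlow (by ring) (by positivity) hab hbc (by positivity)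
  -- the threshold `q`
  obtain ⟨q, hq⟩ : ∃ q : ℝ, q = lam ^ 2 * f ^ 2 / (1500000 * (ℓ ^ 2) ^ 2) := ⟨_, rfl⟩
  have hq0 : 0 < q := by rw [hq]; positivity
  by_contra hcon
  rw [not_or, not_or, not_le, not_le, not_le] at hcon
  obtain ⟨h1, h2, h3⟩ := hcon
  have hlt : ∀ {x : ℝ}, 1500000 * (ℓ ^ 2) ^ 2 * x < lam ^ 2 * f ^ 2 → x < q := by
    intro x hx
    rw [hq, lt_div_iff₀ (by positivity)]
    linarith only [hx]
  have hq1 := hlt h1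
  have hq2 := hlt h2
  have hq3 := hlt h3
  -- the pair terms: `√(xy (1 + log n) log(4 n n!/(xy))) ≤ (5/2) ℓ² √q`
  have hXle : ∀ {x : ℝ}, lam ^ 2 * f ^ 2 / s ^ 2 ≤ x → x < q →
      Real.sqrt (x * ((1 + Real.log n) * Real.log (4 * n * n.factorial / x))) ≤ 5 / 2 * ℓ ^ 2 * Real.sqrt q := by
    intro x hxl hxq
    have hx : 0 < x := lt_of_lt_of_le (by positivity) hxl
    have hL : Real.log (4 * n * n.factorial / x) ≤ 3 * ℓ ^ 2 := by
      have hqq : 4 * n * n.factorial / x ≤ (n : ℝ) ^ 3 := by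
        rw [div_le_iff₀ hx, hFf, hns]
        calc 4 * s ^ 2 * f ^ 2 = 4 * (s ^ 2) ^ 2 / lam ^ 2 * (lam ^ 2 * f ^ 2 / s ^ 2) := by field_simp
          _ ≤ 4 * (s ^ 2) ^ 2 / lam ^ 2 * x := mul_le_mul_of_nonneg_left hxl (by positivity)
          _ ≤ (s ^ 2) ^ 3 * x := by
              refine mul_le_mul_of_nonneg_right ?_ hx.le
              rw [div_le_iff₀ (by positivity)]
              have h4 : 0 ≤ s ^ 4 * ((lam * s) ^ 2 - 4) := mul_nonneg (pow_nonneg hs0.le 4) (by nlinarith only [hls])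
              nlinarith only [h4]
      calc Real.log (4 * n * n.factorial / x) ≤ Real.log ((n : ℝ) ^ 3) :=
            Real.log_le_log (by rw [hFf]; positivity) hqq
        _ = 3 * ℓ ^ 2 := by rw [Real.log_pow, hlog]; push_cast; ring
    have hGL : (1 + Real.log n) * Real.log (4 * n * n.factorial / x) ≤ (5 / 2 * ℓ ^ 2) ^ 2 := by
      have hG : 1 + Real.log n ≤ 2 * ℓ ^ 2 := by rw [← hlog]; linarith only [hlog1]
      have hG0 : 0 ≤ 1 + Real.log n := by rw [hlog]; positivity
      calc (1 + Real.log n) * Real.log (4 * n * n.factorial / x) ≤ (1 + Real.log n) * (3 * ℓ ^ 2) :=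
            mul_le_mul_of_nonneg_left hL hG0
        _ ≤ (2 * ℓ ^ 2) * (3 * ℓ ^ 2) := mul_le_mul_of_nonneg_right hG (by positivity)
        _ ≤ (5 / 2 * ℓ ^ 2) ^ 2 := by nlinarith only [pow_nonneg hℓpos.le 4]
    calc Real.sqrt (x * ((1 + Real.log n) * Real.log (4 * n * n.factorial / x)))
        ≤ Real.sqrt (x * (5 / 2 * ℓ ^ 2) ^ 2) := Real.sqrt_le_sqrt (mul_le_mul_of_nonneg_left hGL hx.le)
      _ = Real.sqrt x * (5 / 2 * ℓ ^ 2) := by rw [Real.sqrt_mul hx.le, Real.sqrt_sq (by positivity)]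
      _ ≤ Real.sqrt q * (5 / 2 * ℓ ^ 2) := mul_le_mul_of_nonneg_right (Real.sqrt_le_sqrt hxq.le) (by positivity)
      _ = 5 / 2 * ℓ ^ 2 * Real.sqrt q := by ring
  have hX1 := hXle hlab hq1
  have hX2 := hXle hlbc hq2
  have hX3 := hXle hlca hq3
  -- the middle term: `n! √(n!)/√(n(n-1)/6) ≤ √12 f^3/n ≤ 4 f² f / n`
  have hs12 : Real.sqrt 12 < 4 := by
    rw [show (4 : ℝ) = Real.sqrt 16 by rw [show (16 : ℝ) = 4 ^ 2 by norm_num, Real.sqrt_sq (by norm_num)]]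
    exact Real.sqrt_lt_sqrt (by norm_num) (by norm_num)
  have hG : (n.factorial : ℝ) * Real.sqrt (n.factorial : ℝ) / Real.sqrt (((n * (n - 1) : ℕ) : ℝ) / 6) ≤
      4 * f ^ 2 * f / s ^ 2 := by
    have h2 : ((n * (n - 1) : ℕ) : ℝ) = (n : ℝ) * ((n : ℝ) - 1) := by
      push_cast [Nat.cast_sub (show 1 ≤ n by omega)]; ring
    have hd : (n : ℝ) / Real.sqrt 12 ≤ Real.sqrt (((n * (n - 1) : ℕ) : ℝ) / 6) := by
      rw [h2]
      have h12 : (0 : ℝ) < Real.sqrt 12 := by positivity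
      rw [div_le_iff₀ h12]
      have h6 : (0 : ℝ) ≤ (n : ℝ) * ((n : ℝ) - 1) / 6 :=
        div_nonneg (mul_nonneg hn0.le (by linarith only [h40])) (by norm_num)
      rw [← Real.sqrt_mul h6 12]
      refine (le_of_eq (Real.sqrt_sq hn0.le).symm).trans (Real.sqrt_le_sqrt ?_)
      nlinarith only [h40]
    have hnum : 0 ≤ (n.factorial : ℝ) * Real.sqrt (n.factorial : ℝ) := by positivity
    calc (n.factorial : ℝ) * Real.sqrt (n.factorial : ℝ) / Real.sqrt (((n * (n - 1) : ℕ) : ℝ) / 6)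
        ≤ (n.factorial : ℝ) * Real.sqrt (n.factorial : ℝ) / ((n : ℝ) / Real.sqrt 12) :=
          div_le_div_of_nonneg_left hnum (by positivity) hd
      _ = Real.sqrt 12 * f ^ 2 * f / s ^ 2 := by rw [← hf, hFf, hns]; field_simp
      _ ≤ 4 * f ^ 2 * f / s ^ 2 := by
          rw [div_le_div_iff_of_pos_right (by positivity)]
          exact mul_le_mul_of_nonneg_right (mul_le_mul_of_nonneg_right hs12.le (by positivity)) hf0.le
  -- assemble: `abc/4 ≤ f² + 4 f² f/s² + 150 f² ℓ² √q / s`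
  have h20 : (0 : ℝ) ≤ 20 * (n.factorial : ℝ) / s := by positivity
  have hsumX := mul_le_mul_of_nonneg_left (add_le_add (add_le_add hX1 hX2) hX3) h20
  have hmain : a * b * c / 4 ≤ f ^ 2 + 4 * f ^ 2 * f / s ^ 2 + 150 * f ^ 2 * ℓ ^ 2 * Real.sqrt q / s := by
    have e : 20 * (n.factorial : ℝ) / s *
        (5 / 2 * ℓ ^ 2 * Real.sqrt q + 5 / 2 * ℓ ^ 2 * Real.sqrt q + 5 / 2 * ℓ ^ 2 * Real.sqrt q) =
        150 * f ^ 2 * ℓ ^ 2 * Real.sqrt q / s := by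
      rw [hFf]; ring
    rw [e] at hsumX
    linarith only [hW, hG, hsumX, hFf]
  -- the first two terms are at most `abc/16` each
  have hV64' : 64 * (f ^ 2 * f) ≤ a * b * c * s ^ 2 := by
    have := hV64; rw [div_le_iff₀ (by positivity)] at this; exact this
  have hT1 : f ^ 2 ≤ a * b * c / 16 := by
    rw [le_div_iff₀ (by norm_num : (0 : ℝ) < 16)]
    have h1 : f ^ 2 * 16 * s ^ 2 ≤ 64 * (f ^ 2 * f) := by nlinarith only [hfn, sq_nonneg f]
    exact le_of_mul_le_mul_right (h1.trans hV64') (by positivity)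
  have hT2 : 4 * f ^ 2 * f / s ^ 2 ≤ a * b * c / 16 := by
    rw [div_le_iff₀ (by positivity)]
    linarith only [hV64']
  have h8 : a * b * c / 8 ≤ 150 * f ^ 2 * ℓ ^ 2 * Real.sqrt q / s := by linarith only [hmain, hT1, hT2, hV0]
  -- clear the denominator and square: `(abc·s)² ≤ 1200² f⁴ ℓ⁴ q = 0.96 λ² f⁶`, contradicting `abc·s ≥ λ f³`
  rw [le_div_iff₀ hs0] at h8
  have h8' : a * b * c * s ≤ 1200 * f ^ 2 * ℓ ^ 2 * Real.sqrt q := by linarith only [h8]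
  have hsq2 : (a * b * c * s) ^ 2 ≤ (1200 * f ^ 2 * ℓ ^ 2 * Real.sqrt q) ^ 2 :=
    pow_le_pow_left₀ (by positivity) h8' 2
  have hq2 : Real.sqrt q ^ 2 = q := Real.sq_sqrt hq0.le
  have e2 : (1200 * f ^ 2 * ℓ ^ 2 * Real.sqrt q) ^ 2 = 1440000 * f ^ 4 * (ℓ ^ 2) ^ 2 * q := by
    rw [mul_pow, mul_pow, mul_pow, hq2]; ring
  have e3 : 1440000 * f ^ 4 * (ℓ ^ 2) ^ 2 * q = 24 / 25 * (lam * (f ^ 2 * f)) ^ 2 := by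
    rw [hq]; field_simp; ring
  have hbig2 : (lam * (f ^ 2 * f)) ^ 2 ≤ (a * b * c * s) ^ 2 := by
    rw [← mul_div_assoc, div_le_iff₀ hs0] at hbig
    exact pow_le_pow_left₀ (by positivity) hbig 2
  have hpos : 0 < (lam * (f ^ 2 * f)) ^ 2 := by positivity
  rw [e2, e3] at hsq2
  linarith only [hsq2, hbig2, hpos]

end Summit.MatrixMultiplication.MatrixMultiplication.Theorems.PolynomialSlack
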